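import Mathlib
import Summits.Ventures.PercRepro.TriangleCapOneTriangleB

/-!
# PercRepro — the one-triangle case, part C: the sparse exception and THE THEOREM (p3, gen 34; part 33c)

* `classify_triangle` — around a triangle `u v w` of a `K₄⁻`-free graph every vertex is `u`, `v`, `w`, a private
  neighbour of one of them, or outer;
* `sparse_of_priv_empty` — if `v` and `w` have no private neighbours, every triangle is `{u, v, w}` and there is
  at most one outer vertex, then `2m + 10 ≤ 4k`: such a graph is not in the dense corner `m ≥ 2k − 3`;
* **`one_triangle_stability`** — a `K₄⁻`-free graph on `k ≥ 10` vertices with `m ≥ 2k − 3` edges whose only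
  triangle is `u v w` has `Σ_v d(v)² + (k − 2) ≤ m·k`.

Axioms: standard.
-/

namespace PercRepro

namespace TriangleCap

namespace C047

open Finset

variable {V : Type*} [Fintype V] [DecidableEq V]

omit [DecidableEq V] in
/-- `outer` is symmetric in its three vertices (two transpositions). -/
theorem outer_comm₁ (D : SimpleGraph V) [DecidableRel D.Adj] (u v w : V) :
    outer D u v w = outer D v u w := by
  ext x; rw [mem_outer, mem_outer]; tauto

omit [DecidableEq V] in
/-- `outer` is symmetric in its three vertices (the other transposition). -/
theorem outer_comm₂ (D : SimpleGraph V) [DecidableRel D.Adj] (u v w : V) :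
    outer D u v w = outer D w u v := by
  ext x; rw [mem_outer, mem_outer]; tauto

/-- Every vertex is one of the triangle's vertices, a private neighbour of one of them, or outer. -/
theorem classify_triangle (D : SimpleGraph V) [DecidableRel D.Adj] (hK : K4mFree D) {u v w : V}
    (huv : D.Adj u v) (huw : D.Adj u w) (hvw : D.Adj v w) (x : V) :
    x = u ∨ x = v ∨ x = w ∨ x ∈ priv D u v w ∨ x ∈ priv D v u w ∨ x ∈ priv D w u v ∨
      x ∈ outer D u v w := by
  by_cases hxu : x = u
  · exact Or.inl hxu
  by_cases hxv : x = v
  · exact Or.inr (Or.inl hxv)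
  by_cases hxw : x = w
  · exact Or.inr (Or.inr (Or.inl hxw))
  simp only [mem_priv, mem_outer]
  by_cases hu : D.Adj u x <;> by_cases hv : D.Adj v x <;> by_cases hw : D.Adj w x
  · exact (not_adj_both D hK huv huw hvw (Ne.symm hxw) hu hv).elim
  · exact (not_adj_both D hK huv huw hvw (Ne.symm hxw) hu hv).elim
  · exact (not_adj_both D hK huw huv hvw.symm (Ne.symm hxv) hu hw).elim
  · exact Or.inr (Or.inr (Or.inr (Or.inl ⟨hu, hv, hw⟩)))
  · exact (not_adj_both D hK hvw huv.symm huw.symm (Ne.symm hxu) hv hw).elim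
  · exact Or.inr (Or.inr (Or.inr (Or.inr (Or.inl ⟨hv, hu, hw⟩))))
  · exact Or.inr (Or.inr (Or.inr (Or.inr (Or.inr (Or.inl ⟨hw, hu, hv⟩)))))
  · exact Or.inr (Or.inr (Or.inr (Or.inr (Or.inr (Or.inr ⟨hu, hv, hw⟩)))))

omit [DecidableEq V] in
/-- The degree is the size of the neighbourhood filter. -/
theorem deg_le_of_subset (D : SimpleGraph V) [DecidableRel D.Adj] (x : V) (S : Finset V)
    (h : ∀ y, D.Adj x y → y ∈ S) : deg D x ≤ S.card := by
  unfold deg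
  apply card_le_card
  intro y hy
  rw [mem_filter] at hy
  exact h y hy.2

/-- **THE SPARSE EXCEPTION:** if `v` and `w` have no private neighbours, every triangle is `{u, v, w}`, and at
most one vertex is outer, then `2m + 10 ≤ 4k`. -/
theorem sparse_of_priv_empty (D : SimpleGraph V) [DecidableRel D.Adj] (hK : K4mFree D) {u v w : V}
    (huv : D.Adj u v) (huw : D.Adj u w) (hvw : D.Adj v w)
    (hT : ∀ a b c, D.Adj a b → D.Adj a c → D.Adj b c → a = u ∨ a = v ∨ a = w)
    (hv : priv D v u w = ∅) (hw : priv D w u v = ∅) (hQ : (outer D u v w).card ≤ 1)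
    (hk : 5 ≤ Fintype.card V) :
    2 * D.edgeFinset.card + 10 ≤ 4 * Fintype.card V := by
  have hpart := card_partition_triangle D hK huv huw hvw
  rw [hv, hw] at hpart
  simp only [card_empty, add_zero] at hpart
  set a := (priv D u v w).card with ha
  set q := (outer D u v w).card with hq
  -- the pointwise degree bound
  have hdeg : ∀ x, deg D x ≤ (if x = u then a + 2 else 0) + (if x = v then 2 else 0) +
      (if x = w then 2 else 0) + (if x ∈ priv D u v w then 1 + q else 0) +
      (if x ∈ outer D u v w then a else 0) := by
    intro x
    rcases classify_triangle D hK huv huw hvw x with rfl | rfl | rfl | hx | hx | hx | hx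
    · -- `x = u`: neighbours `v`, `w`, and the private neighbours
      have h1 : x ∉ priv D x v w := by rw [mem_priv]; exact fun h => h.1.ne rfl
      have h2 : x ∉ outer D x v w := by rw [mem_outer]; exact fun h => h.2.1 huv.symm
      simp only [if_true, if_neg huv.ne, if_neg huw.ne, if_neg h1, if_neg h2, add_zero]
      have hsub : ∀ y, D.Adj x y → y ∈ insert v (insert w (priv D x v w)) := by
        intro y hy
        rcases classify_triangle D hK huv huw hvw y with rfl | rfl | rfl | h | h | h | h
        · exact (hy.ne rfl).elim
        · simp
        · simp
        · exact mem_insert_of_mem (mem_insert_of_mem h)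
        · rw [mem_priv] at h; exact (h.2.1 hy).elim
        · rw [mem_priv] at h; exact (h.2.1 hy).elim
        · rw [mem_outer] at h; exact (h.1 hy).elim
      have hd := deg_le_of_subset D x _ hsub
      have c1 := card_insert_le v (insert w (priv D x v w))
      have c2 := card_insert_le w (priv D x v w)
      omega
    · -- `x = v`
      have h1 : x ∉ priv D u x w := by rw [mem_priv]; exact fun h => h.2.2 hvw.symm
      have h2 : x ∉ outer D u x w := by rw [mem_outer]; exact fun h => h.1 huv
      simp only [if_true, if_neg huv.ne.symm, if_neg hvw.ne, if_neg h1, if_neg h2, add_zero, zero_add]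
      have hsub : ∀ y, D.Adj x y → y ∈ ({u, w} : Finset V) := by
        intro y hy
        rcases classify_triangle D hK huv huw hvw y with rfl | rfl | rfl | h | h | h | h
        · simp
        · exact (hy.ne rfl).elim
        · simp
        · rw [mem_priv] at h; exact (h.2.1 hy).elim
        · rw [hv] at h; exact (notMem_empty _ h).elim
        · rw [mem_priv] at h; exact (h.2.2 hy).elim
        · rw [mem_outer] at h; exact (h.2.1 hy).elim
      exact le_trans (deg_le_of_subset D x _ hsub) card_le_two
    · -- `x = w`
      have h1 : x ∉ priv D u v x := by rw [mem_priv]; exact fun h => h.2.1 hvw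
      have h2 : x ∉ outer D u v x := by rw [mem_outer]; exact fun h => h.1 huw
      simp only [if_true, if_neg huw.ne.symm, if_neg hvw.ne.symm, if_neg h1, if_neg h2, add_zero,
        zero_add]
      have hsub : ∀ y, D.Adj x y → y ∈ ({u, v} : Finset V) := by
        intro y hy
        rcases classify_triangle D hK huv huw hvw y with rfl | rfl | rfl | h | h | h | h
        · simp
        · simp
        · exact (hy.ne rfl).elim
        · rw [mem_priv] at h; exact (h.2.2 hy).elim
        · rw [mem_priv] at h; exact (h.2.2 hy).elim
        · rw [hw] at h; exact (notMem_empty _ h).elim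
        · rw [mem_outer] at h; exact (h.2.2 hy).elim
      exact le_trans (deg_le_of_subset D x _ hsub) card_le_two
    · -- `x ∈ priv u`: neighbours `u` and outer vertices
      have hx' := (mem_priv D u v w x).mp hx
      have hxu : x ≠ u := fun h => hx'.1.ne h.symm
      have hxv : x ≠ v := fun h => hx'.2.2 (h ▸ hvw.symm)
      have hxw : x ≠ w := fun h => hx'.2.1 (h ▸ hvw)
      have h2 : x ∉ outer D u v w := by rw [mem_outer]; exact fun h => h.1 hx'.1
      simp only [if_neg hxu, if_neg hxv, if_neg hxw, if_pos hx, if_neg h2, add_zero, zero_add]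
      have hsub : ∀ y, D.Adj x y → y ∈ insert u (outer D u v w) := by
        intro y hy
        rcases classify_triangle D hK huv huw hvw y with rfl | rfl | rfl | h | h | h | h
        · exact mem_insert_self _ _
        · exact (hx'.2.1 hy.symm).elim
        · exact (hx'.2.2 hy.symm).elim
        · -- a second triangle `u x y`
          exfalso
          have h' := (mem_priv D u v w y).mp h
          rcases hT x u y hx'.1.symm hy h'.1 with h3 | h3 | h3
          · exact hxu h3
          · exact hxv h3
          · exact hxw h3
        · rw [hv] at h; exact (notMem_empty _ h).elim
        · rw [hw] at h; exact (notMem_empty _ h).elim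
        · exact mem_insert_of_mem h
      have hd := deg_le_of_subset D x _ hsub
      have c1 := card_insert_le u (outer D u v w)
      omega
    · rw [hv] at hx; exact (notMem_empty _ hx).elim
    · rw [hw] at hx; exact (notMem_empty _ hx).elim
    · -- `x` outer: neighbours among the private neighbours of `u`
      have hx' := (mem_outer D u v w x).mp hx
      have hxu : x ≠ u := fun h => hx'.2.1 (h ▸ huv.symm)
      have hxv : x ≠ v := fun h => hx'.1 (h ▸ huv)
      have hxw : x ≠ w := fun h => hx'.1 (h ▸ huw)
      have h1 : x ∉ priv D u v w := by rw [mem_priv]; exact fun h => hx'.1 h.1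
      simp only [if_neg hxu, if_neg hxv, if_neg hxw, if_neg h1, if_pos hx, zero_add]
      apply deg_le_of_subset D x (priv D u v w)
      intro y hy
      rcases classify_triangle D hK huv huw hvw y with rfl | rfl | rfl | h | h | h | h
      · exact (hx'.1 hy.symm).elim
      · exact (hx'.2.1 hy.symm).elim
      · exact (hx'.2.2 hy.symm).elim
      · exact h
      · rw [hv] at h; exact (notMem_empty _ h).elim
      · rw [hw] at h; exact (notMem_empty _ h).elim
      · exfalso
        have := card_le_one.mp hQ x hx y h
        exact hy.ne this
  have hsum := sum_le_sum (fun x (_ : x ∈ univ) => hdeg x)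
  rw [sum_deg_eq] at hsum
  simp only [sum_add_distrib, sum_ite_eq', mem_univ, if_true, sum_ite_mem, univ_inter, sum_const,
    smul_eq_mul] at hsum
  rw [← ha, ← hq] at hsum
  have hq' : q = 0 ∨ q = 1 := by omega
  rcases hq' with hq' | hq'
  · rw [hq'] at hsum hpart
    nlinarith [hsum, hpart]
  · rw [hq'] at hsum hpart
    nlinarith [hsum, hpart]

end C047

end TriangleCap

end PercRepro
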